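import Mathlib.Analysis.Normed.Module.Ball.Homeomorph
import Mathlib.Analysis.Convex.Contractible
import Literature.AlgebraicTopology.FundamentalGroupoid.SimplyConnectedComplPoint
import HarnessLib

/-!
# The complement of a locally finite set in a Euclidean space of dimension `≥ 3` is simply connected

Sibling of `SimplyConnectedComplPoint.lean` (general position off one point). For a
finite-dimensional real normed space `E` with `3 ≤ dim E` we prove:

* `Literature.AlgebraicTopology.FundamentalGroupoid.isSimplyConnected_ball_diff_finset`: an open ball minus finitely many points is simply
  connected (induction on the finite set, removing one point at a time from the simply connected
  open set `ball ∖ F` by `Literature.AlgebraicTopology.FundamentalGroupoid.isSimplyConnected_compl_singleton_of_isOpenEmbedding`, the removed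
  point having the Euclidean neighbourhood `OpenPartialHomeomorph.univBall`);
* `Literature.AlgebraicTopology.FundamentalGroupoid.isSimplyConnected_compl_of_finite_inter_closedBall`: if `L ⊆ E` meets every closed ball
  in a finite set (e.g. a lattice), then `E ∖ L` is simply connected: a loop in `E ∖ L`, being
  compact, lies in some ball `B`, and is null-homotopic in `B ∖ (L ∩ B̄)` by the first result.

These are the general position statements `π₁(ℝⁿ ∖ discrete) = 1`, `n ≥ 3`, used for the
universal cover `ℝ × (ℝ³ ∖ ℤ³)` of the complement of the section circle of a Cappell–Shaneson
mapping torus (Hatcher, *Algebraic Topology* (2002), proof of Prop. 1.14 for the method;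
Kosinski, *Differential Manifolds* (1993), VI.2). No new definitions.
-/

noncomputable section

open Set Metric Topology unitInterval Function Module Filter

namespace Literature.AlgebraicTopology.FundamentalGroupoid

variable {E : Type*} [NormedAddCommGroup E] [NormedSpace ℝ E] [FiniteDimensional ℝ E]

/-- An open embedding of a space into an open subset `S ⊇ range f` of the target is an open
embedding into the subtype `↥S`. [folklore] -/
theorem isOpenEmbedding_codRestrict {X Y : Type*} [TopologicalSpace X] [TopologicalSpace Y]
    {f : X → Y} (hf : IsOpenEmbedding f) {S : Set Y} (hS : ∀ x, f x ∈ S) :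
    IsOpenEmbedding (S.codRestrict f hS) := by
  refine ⟨hf.isEmbedding.codRestrict S hS, ?_⟩
  have : range (S.codRestrict f hS) = Subtype.val ⁻¹' range f := by
    ext ⟨y, hy⟩
    simp only [mem_range, mem_preimage, Subtype.ext_iff, val_codRestrict_apply]
  rw [this]
  exact hf.isOpen_range.preimage continuous_subtype_val

/-- **An open ball minus finitely many points is simply connected** in dimension `≥ 3`
(induction on the number of points; each point is removed from the simply connected open set
`ball c R ∖ F` by general position, `isSimplyConnected_compl_singleton_of_isOpenEmbedding`)
(Hatcher, *Algebraic Topology* (2002), proof of Prop. 1.14). [folklore] -/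
theorem isSimplyConnected_ball_diff_finset (h3 : 2 < finrank ℝ E) (c : E) {R : ℝ} (hR : 0 < R)
    (F : Finset E) : IsSimplyConnected (ball c R \ (F : Set E)) := by
  classical
  induction F using Finset.induction_on with
  | empty =>
    rw [Finset.coe_empty, sdiff_empty]
    haveI := (convex_ball c R).contractibleSpace ⟨c, mem_ball_self hR⟩
    change SimplyConnectedSpace (ball c R)
    infer_instance
  | insert p F hpF ih =>
    by_cases hp : p ∈ ball c R
    · -- remove the point `p` from the simply connected open set `S = ball c R ∖ F`
      set S : Set E := ball c R \ (F : Set E) with hS_def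
      have hSo : IsOpen S := isOpen_ball.sdiff F.finite_toSet.isClosed
      have hpS : p ∈ S := ⟨hp, fun h ↦ hpF (by exact_mod_cast h)⟩
      obtain ⟨r, hr, hrS⟩ := Metric.isOpen_iff.1 hSo p hpS
      haveI : SimplyConnectedSpace S := ih
      -- the Euclidean neighbourhood `ball p r ⊆ S` of `p`
      let e := OpenPartialHomeomorph.univBall p r
      have he : IsOpenEmbedding e := e.to_isOpenEmbedding (OpenPartialHomeomorph.univBall_source p r)
      have he_mem : ∀ v, e v ∈ S := fun v ↦ hrS <| by
        rw [← OpenPartialHomeomorph.univBall_target p hr]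
        exact e.map_source (by rw [OpenPartialHomeomorph.univBall_source]; exact mem_univ v)
      let i : E → S := S.codRestrict e he_mem
      have hi : IsOpenEmbedding i := isOpenEmbedding_codRestrict he he_mem
      have hi0 : (i 0 : E) = p := OpenPartialHomeomorph.univBall_apply_zero p r
      have h := isSimplyConnected_compl_singleton_of_isOpenEmbedding hi h3
      rw [← IsEmbedding.subtypeVal.isSimplyConnected_image] at h
      convert h using 1
      ext x
      simp only [Finset.coe_insert, Set.mem_sdiff, mem_insert_iff, not_or, mem_image, mem_compl_iff,
        mem_singleton_iff, Subtype.exists, exists_and_right, exists_eq_right]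
      constructor
      · rintro ⟨hx, hxp, hxF⟩
        refine ⟨⟨hx, hxF⟩, fun h' ↦ hxp ?_⟩
        rw [← hi0, ← h']
      · rintro ⟨⟨hx, hxF⟩, h'⟩
        refine ⟨hx, fun hxp ↦ h' ?_, hxF⟩
        exact Subtype.ext (hxp.trans hi0.symm)
    · rw [Finset.coe_insert, sdiff_insert_of_notMem hp]
      exact ih

/-- **The complement of a locally finite set is simply connected** in dimension `≥ 3`: if
`L ⊆ E` meets every closed ball in a finite set, then `E ∖ L` is simply connected. A loop (or a
pair of points) of `E ∖ L` lies in a ball `ball 0 R`, inside which it avoids the finite set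
`L ∩ closedBall 0 R`, so `isSimplyConnected_ball_diff_finset` applies
(Hatcher, *Algebraic Topology* (2002), proof of Prop. 1.14). [folklore] -/
theorem isSimplyConnected_compl_of_finite_inter_closedBall (h3 : 2 < finrank ℝ E) {L : Set E}
    (hL : ∀ R : ℝ, (L ∩ closedBall 0 R).Finite) : IsSimplyConnected Lᶜ := by
  classical
  -- the finite sets `F R = L ∩ closedBall 0 R` and the inclusions `ball 0 R ∖ F R ⊆ Lᶜ`
  have hsub : ∀ R : ℝ, ball (0 : E) R \ ((hL R).toFinset : Set E) ⊆ Lᶜ := by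
    intro R x ⟨hx, hxF⟩ hxL
    exact hxF (by
      rw [Finite.coe_toFinset]
      exact ⟨hxL, ball_subset_closedBall hx⟩)
  have hsc : ∀ R : ℝ, 0 < R → IsSimplyConnected (ball (0 : E) R \ ((hL R).toFinset : Set E)) :=
    fun R hR ↦ isSimplyConnected_ball_diff_finset h3 0 hR _
  have hmem : ∀ (R : ℝ) (x : E), x ∈ Lᶜ → ‖x‖ < R →
      x ∈ ball (0 : E) R \ ((hL R).toFinset : Set E) := by
    intro R x hx hxR
    refine ⟨mem_ball_zero_iff.2 hxR, fun h ↦ hx ?_⟩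
    rw [Finite.coe_toFinset] at h
    exact h.1
  rw [isSimplyConnected_iff_exists_homotopy_refl_forall_mem]
  refine ⟨?_, fun x γ hγ ↦ ?_⟩
  · -- path connected
    rw [isPathConnected_iff]
    refine ⟨?_, ?_⟩
    · obtain ⟨x, hx⟩ := (hsc 1 one_pos).nonempty
      exact ⟨x, hsub 1 hx⟩
    · intro x hx y hy
      set R : ℝ := max ‖x‖ ‖y‖ + 1 with hR_def
      have hR : 0 < R := by positivity
      have hxR : ‖x‖ < R := by rw [hR_def]; linarith [le_max_left ‖x‖ ‖y‖]
      have hyR : ‖y‖ < R := by rw [hR_def]; linarith [le_max_right ‖x‖ ‖y‖]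
      exact ((hsc R hR).isPathConnected.joinedIn x (hmem R x hx hxR) y (hmem R y hy hyR)).mono
        (hsub R)
  · -- loops are null-homotopic
    obtain ⟨R₀, hR₀⟩ := (isBounded_iff_subset_ball (0 : E)).1
      (isCompact_range γ.continuous).isBounded
    set R : ℝ := max R₀ 1 with hR_def
    have hR : 0 < R := lt_of_lt_of_le one_pos (le_max_right _ _)
    have hγR : ∀ t, γ t ∈ ball (0 : E) R \ ((hL R).toFinset : Set E) := fun t ↦
      hmem R (γ t) (hγ t) (by
        have := hR₀ (mem_range_self t)
        rw [mem_ball_zero_iff] at this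
        exact lt_of_lt_of_le this (le_max_left _ _))
    obtain ⟨F, hF⟩ :=
      (isSimplyConnected_iff_exists_homotopy_refl_forall_mem.1 (hsc R hR)).2 x γ hγR
    exact ⟨F, fun t ↦ hsub R (hF t)⟩

end Literature.AlgebraicTopology.FundamentalGroupoid
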